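import Literature.Geometry.DiscreteGeometry.ShellCensusReplayLP
import HarnessLib

/-!
# Soundness of the census checker with LP leaves

Topic `Literature/Geometry/DiscreteGeometry`; part 2 of 3 of the replayer extension
`ShellCensusReplayLP.lean` (certificate stubs `stub_ffrC5NoOpenStar` / `stub_ffrC5NoFarFacet` of
crux `FiveFoldRationingR`, stmt-AtomisticToContinuum-18071). Contents:

* algebra of the dense forms: `QF.eval_zero`, `QF.eval_addMono` (the table index
  `min i j · (m+1) + max i j` decodes back to the monomial `X_i X_j`), `QF.eval_addScaled`,
  `Spec.eval_lpForm` (`lpForm` evaluates to `c + Σ λ_g · poly g`), `QF.eval_of_isZero`;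
* semantics of the generators: `Gen.seval_poly_nonneg` — every valid generator polynomial is
  `≥ 0` at `flat t` for admissible `t` satisfying the constraints in the box (`norm_sq_fin3`,
  `dist_sq_fin3`, `Box.mem`, products of nonnegative bound factors);
* the rule **`Spec.efclaim_of_lp`** (the box of an accepted `lp` leaf is infeasible:
  `0 = eval (lpForm) = c + Σ λ_g · (≥ 0) ≥ c > 0`), the induction `LTree.check_sound` reusing the
  rule lemmas of `ShellCensusReplaySound.lean` / `ShellCensusReplayEscapeSound.lean`,
  `LCensus.checkFrom_sound`, **`LCensus.check_sound`**, and for specifications without anchors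
  **`LCensus.infeasible_of_check`** — the entry point of the certificate stubs:
  `LCensus.infeasible_of_check rfl C (by native_decide) t hadm hdeg hfacet hsat : False`.
  Composition across files and the text decoder are in part 3.

## References
* H. D. Sherali, W. P. Adams, SIAM J. Discrete Math. 3 (1990), §2. [cite: SheraliAdams1990, §2]
* R. E. Moore, *Interval Analysis* (1966), §4.4. [cite: Moore1966, §4.4]
-/

namespace Literature.Geometry.DiscreteGeometry

open Literature.Analysis.ValidatedNumerics NonemptyInterval Finset

namespace ShellCensus

/-! ### Algebra of the dense forms -/

namespace QF

variable {m : ℕ} {x : ℕ → ℝ}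

/-- The table index of an in-range monomial is in range. [folklore] -/
theorem idx_lt {i j : ℕ} (hi : i ≤ m) (hj : j ≤ m) : idx m i j < (m + 1) * (m + 1) := by
  unfold idx
  have h1 : min i j * (m + 1) ≤ m * (m + 1) := Nat.mul_le_mul_right _ ((min_le_left i j).trans hi)
  have h2 : max i j ≤ m := max_le hi hj
  have h3 : (m + 1) * (m + 1) = m * (m + 1) + (m + 1) := Nat.succ_mul m (m + 1)
  linarith

/-- Decoding the table index: the row is `min i j`. [folklore] -/
theorem idx_div {i j : ℕ} (hi : i ≤ m) (hj : j ≤ m) : idx m i j / (m + 1) = min i j := by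
  rw [idx, add_comm, Nat.add_mul_div_right _ _ (Nat.succ_pos m),
    Nat.div_eq_of_lt (Nat.lt_succ_of_le (max_le hi hj)), zero_add]

/-- Decoding the table index: the column is `max i j`. [folklore] -/
theorem idx_mod {i j : ℕ} (hi : i ≤ m) (hj : j ≤ m) : idx m i j % (m + 1) = max i j := by
  rw [idx, add_comm, Nat.add_mul_mod_self_right, Nat.mod_eq_of_lt (Nat.lt_succ_of_le (max_le hi hj))]

/-- The symmetrised monomial is the monomial. [folklore] -/
theorem hvar_min_mul_max (x : ℕ → ℝ) (i j : ℕ) :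
    hvar x (min i j) * hvar x (max i j) = hvar x i * hvar x j := by
  rcases le_total i j with h | h
  · rw [min_eq_left h, max_eq_right h]
  · rw [min_eq_right h, max_eq_left h, mul_comm]

/-- Size of the zero form. [folklore] -/
theorem size_zero : (zero m).size = (m + 1) * (m + 1) := Array.size_replicate

/-- The zero form evaluates to `0`. [folklore] -/
theorem eval_zero : (zero m).eval m x = 0 := by
  refine sum_eq_zero fun p hp => ?_
  rw [zero, Array.getElem?_replicate, if_pos (mem_range.1 hp)]
  simp

/-- `addMono` preserves the size. [folklore] -/
theorem size_addMono (q : QF) (i j : ℕ) (c : ℚ) : (q.addMono m i j c).size = q.size := by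
  unfold addMono; split <;> simp

/-- Coefficients after `addMono`. [folklore] -/
theorem getD_addMono (q : QF) {i j : ℕ} (c : ℚ) (h : idx m i j < q.size) (p : ℕ) :
    (q.addMono m i j c)[p]?.getD 0 = q[p]?.getD 0 + if p = idx m i j then c else 0 := by
  unfold addMono
  rw [dif_pos h, Array.getElem?_set h]
  by_cases hp : p = idx m i j
  · subst hp
    rw [if_pos rfl, if_pos rfl, Array.getElem?_eq_getElem h]
    rfl
  · rw [if_neg (Ne.symm hp), if_neg hp, add_zero]

/-- **`addMono` adds the monomial** (in range, on a full-size table). [folklore] -/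
theorem eval_addMono (q : QF) (hq : q.size = (m + 1) * (m + 1)) {i j : ℕ} (hi : i ≤ m) (hj : j ≤ m)
    (c : ℚ) : (q.addMono m i j c).eval m x = q.eval m x + c * (hvar x i * hvar x j) := by
  have hlt : idx m i j < q.size := hq ▸ idx_lt hi hj
  have key : ∀ p ∈ range ((m + 1) * (m + 1)),
      (((q.addMono m i j c)[p]?.getD 0 : ℚ) : ℝ) * (hvar x (p / (m + 1)) * hvar x (p % (m + 1))) =
        ((q[p]?.getD 0 : ℚ) : ℝ) * (hvar x (p / (m + 1)) * hvar x (p % (m + 1))) +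
          if p = idx m i j then (c : ℝ) * (hvar x (p / (m + 1)) * hvar x (p % (m + 1))) else 0 := by
    intro p _
    rw [getD_addMono q c hlt]
    split_ifs <;> push_cast <;> ring
  unfold eval
  rw [sum_congr rfl key, sum_add_distrib, sum_ite_eq', if_pos (mem_range.2 (idx_lt hi hj)),
    idx_div hi hj, idx_mod hi hj, hvar_min_mul_max]

/-- `addScaled` preserves the size. [folklore] -/
theorem size_addScaled (lam : ℚ) : ∀ (L : List Mono) (q : QF), (addScaled m lam q L).size = q.size
  | [], _ => rfl
  | (i, j, c) :: rest, q => by rw [addScaled, size_addScaled lam rest, size_addMono]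

/-- **`addScaled` adds the scaled sparse polynomial** (monomials in range). [folklore] -/
theorem eval_addScaled (lam : ℚ) : ∀ (L : List Mono) (q : QF), q.size = (m + 1) * (m + 1) →
    monosLE m L = true → (addScaled m lam q L).eval m x = q.eval m x + lam * seval x L
  | [], q, _, _ => by simp [addScaled, seval]
  | (i, j, c) :: rest, q, hq, hL => by
    simp only [monosLE, List.all_cons, Bool.and_eq_true, decide_eq_true_eq] at hL
    obtain ⟨⟨hi, hj⟩, hrest⟩ := hL
    rw [addScaled, eval_addScaled lam rest _ (by rw [size_addMono]; exact hq) hrest,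
      eval_addMono q hq hi hj]
    simp only [seval, List.map_cons, List.sum_cons, Mono.eval]
    push_cast
    ring

/-- **The identity test is sound**: a form with vanishing coefficients evaluates to `0`. [folklore] -/
theorem eval_of_isZero (q : QF) (h : q.isZero = true) : q.eval m x = 0 := by
  refine sum_eq_zero fun p _ => ?_
  suffices h0 : q[p]?.getD 0 = 0 by rw [h0]; simp
  cases hq : q[p]? with
  | none => rfl
  | some v =>
    simp only [isZero, List.all_eq_true, decide_eq_true_eq] at h
    exact h v (Array.mem_def.1 (Array.mem_of_getElem? hq))

end QF

namespace Spec

variable (P : Spec) (B : Box) {x : ℕ → ℝ}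

/-- `addGens` preserves the size. [folklore] -/
theorem size_addGens : ∀ (lams : List (Gen × ℚ)) (q : QF), (P.addGens B q lams).size = q.size
  | [], _ => rfl
  | (g, lam) :: rest, q => by rw [addGens, size_addGens rest, QF.size_addScaled]

/-- `addGens` adds `Σ λ_g · poly g`. [folklore] -/
theorem eval_addGens : ∀ (lams : List (Gen × ℚ)) (q : QF), q.size = (3 * P.n + 1) * (3 * P.n + 1) →
    (∀ gl ∈ lams, monosLE (3 * P.n) (gl.1.poly P B) = true) →
    (P.addGens B q lams).eval (3 * P.n) x =
      q.eval (3 * P.n) x + (lams.map fun gl => (gl.2 : ℝ) * seval x (gl.1.poly P B)).sum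
  | [], q, _, _ => by simp [addGens]
  | (g, lam) :: rest, q, hq, hL => by
    rw [addGens, eval_addGens rest _ (by rw [QF.size_addScaled]; exact hq)
      (fun gl hgl => hL gl (List.mem_cons_of_mem _ hgl)),
      QF.eval_addScaled lam _ q hq (hL (g, lam) List.mem_cons_self)]
    simp only [List.map_cons, List.sum_cons]
    ring

/-- **The form of an `lp` leaf evaluates to `c + Σ λ_g · poly g`.** [folklore] -/
theorem eval_lpForm (c : ℚ) (lams : List (Gen × ℚ))
    (hL : ∀ gl ∈ lams, monosLE (3 * P.n) (gl.1.poly P B) = true) :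
    (P.lpForm B c lams).eval (3 * P.n) x =
      c + (lams.map fun gl => (gl.2 : ℝ) * seval x (gl.1.poly P B)).sum := by
  rw [lpForm, P.eval_addGens B lams _ (by rw [QF.size_addMono, QF.size_zero]) hL,
    QF.eval_addMono _ QF.size_zero (Nat.zero_le _) (Nat.zero_le _), QF.eval_zero]
  simp [hvar]

end Spec

/-! ### Semantics of the generators -/

section Semantics

variable {P : Spec} {t : Fin P.n → EuclideanSpace ℝ (Fin 3)}

/-- `sqNormMonos k s` evaluates to `s ‖t k‖²`. [folklore] -/
theorem seval_sqNormMonos {k : ℕ} (hk : k < P.n) (s : ℚ) :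
    seval (flat t) (sqNormMonos k s) = s * ‖t ⟨k, hk⟩‖ ^ 2 := by
  rw [norm_sq_fin3]
  simp only [seval, sqNormMonos, hv, List.map_cons, List.map_nil, List.sum_cons, List.sum_nil,
    Mono.eval, hvar, Nat.add_zero, flat_apply_zero hk, flat_apply_one hk, flat_apply_two hk]
  ring

/-- `sqDistMonos k l s` evaluates to `s · dist (t k) (t l)²`. [folklore] -/
theorem seval_sqDistMonos {k l : ℕ} (hk : k < P.n) (hl : l < P.n) (s : ℚ) :
    seval (flat t) (sqDistMonos k l s) = s * dist (t ⟨k, hk⟩) (t ⟨l, hl⟩) ^ 2 := by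
  rw [dist_sq_fin3]
  simp only [seval, sqDistMonos, hv, List.map_cons, List.map_nil, List.sum_cons, List.sum_nil,
    Mono.eval, hvar, Nat.add_zero, flat_apply_zero hk, flat_apply_one hk, flat_apply_two hk,
    flat_apply_zero hl, flat_apply_one hl, flat_apply_two hl]
  push_cast
  ring

/-- `affMonos a f` evaluates to the affine function `f.1 x_a + f.2`. [folklore] -/
theorem seval_affMonos (x : ℕ → ℝ) (a : ℕ) (f : ℚ × ℚ) : seval x (affMonos a f) = f.1 * x a + f.2 := by
  simp [seval, affMonos, Mono.eval, hvar]

/-- **Bound factors are nonnegative on the box.** [cite: SheraliAdams1990, §2] -/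
theorem bfac_nonneg {B : Box} {x : ℕ → ℝ} (hB : B.mem x) (a : ℕ) (side : Bool) :
    0 ≤ ((bfac B a side).1 : ℝ) * x a + (bfac B a side).2 := by
  have h := hB a
  cases side
  · simp only [bfac, Bool.false_eq_true, ↓reduceIte]
    push_cast
    linarith [h.1]
  · simp only [bfac, ↓reduceIte]
    push_cast
    linarith [h.2]

/-- The polynomial of `prod a sa b sb` evaluates to the product of the two bound factors. [folklore] -/
theorem seval_poly_prod (B : Box) (x : ℕ → ℝ) (a b : ℕ) (sa sb : Bool) :
    seval x ((Gen.prod a sa b sb).poly P B) =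
      (((bfac B a sa).1 : ℝ) * x a + (bfac B a sa).2) * (((bfac B b sb).1 : ℝ) * x b + (bfac B b sb).2) := by
  simp only [seval, Gen.poly, List.map_cons, List.map_nil, List.sum_cons, List.sum_nil, Mono.eval, hvar]
  push_cast
  ring

/-- **Every valid generator polynomial is nonnegative** at `flat t` for an admissible `t`
satisfying the constraints in the box. [cite: SheraliAdams1990, §2] -/
theorem Gen.seval_poly_nonneg {S : List Constraint} {B : Box} (hP : P.okB = true)
    (ht : P.Admissible t) (hS : P.Sat S t) (hB : B.mem (flat t)) :
    ∀ g : Gen, g.valid P S = true → 0 ≤ seval (flat t) (g.poly P B) := by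
  obtain ⟨hrlo, hdlo, hgap, -, -, -⟩ := Spec.okB_iff.1 hP
  intro g hg
  cases g with
  | normLo k =>
    simp only [Gen.valid, decide_eq_true_eq] at hg
    rw [Gen.poly, seval_append, seval_sqNormMonos hg, seval_const]
    have h1 := pow_le_pow_left₀ (by exact_mod_cast hrlo) (ht.norm_lo ⟨k, hg⟩) 2
    push_cast
    linarith
  | normHi k =>
    simp only [Gen.valid, decide_eq_true_eq] at hg
    rw [Gen.poly, seval_append, seval_sqNormMonos hg, seval_const]
    have h1 := pow_le_pow_left₀ (norm_nonneg _) (ht.norm_hi ⟨k, hg⟩) 2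
    push_cast
    linarith
  | core k l =>
    simp only [Gen.valid, Bool.and_eq_true, decide_eq_true_eq, Bool.not_eq_true', beq_eq_false_iff_ne,
      ne_eq] at hg
    obtain ⟨⟨hk, hl⟩, hkl⟩ := hg
    rw [Gen.poly, seval_append, seval_sqDistMonos hk hl, seval_const]
    have h1 := pow_le_pow_left₀ (by exact_mod_cast hdlo)
      (ht.dist_lo ⟨k, hk⟩ ⟨l, hl⟩ (fun h => hkl (congrArg Fin.val h))) 2
    push_cast
    linarith
  | bond k l =>
    simp only [Gen.valid, Bool.and_eq_true, decide_eq_true_eq] at hg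
    obtain ⟨⟨hk, hl⟩, hmem⟩ := hg
    rw [Gen.poly, seval_append, seval_sqDistMonos hk hl, seval_const]
    have h1 := pow_le_pow_left₀ dist_nonneg ((hS _ hmem hk hl).1 rfl) 2
    push_cast
    linarith
  | far k l =>
    simp only [Gen.valid, Bool.and_eq_true, decide_eq_true_eq] at hg
    obtain ⟨⟨hk, hl⟩, hmem⟩ := hg
    rw [Gen.poly, seval_append, seval_sqDistMonos hk hl, seval_const]
    have h1 := pow_le_pow_left₀ (by exact_mod_cast hgap) ((hS _ hmem hk hl).2 rfl) 2
    push_cast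
    linarith
  | bfLo a =>
    rw [Gen.poly, seval_affMonos]
    exact bfac_nonneg hB a false
  | bfHi a =>
    rw [Gen.poly, seval_affMonos]
    exact bfac_nonneg hB a true
  | prod a sa b sb =>
    rw [seval_poly_prod]
    exact mul_nonneg (bfac_nonneg hB a sa) (bfac_nonneg hB b sb)

end Semantics

/-! ### Soundness of the rule `lp` -/

namespace Spec

variable {P : Spec} {Q : P.Patterns} {dmin dmax : ℕ} {f : Option (ℕ × ℕ × ℕ)}

/-- **Rule `lp`**: an accepted LP certificate leaves no admissible configuration satisfying the
constraints in the box — at such a configuration the form `c + Σ λ_g · poly g` would evaluate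
both to `0` (vanishing coefficients) and to `≥ c > 0`. [cite: SheraliAdams1990, §2] -/
theorem efclaim_of_lp {S : List Constraint} {B : Box} {c : ℚ} {lams : List (Gen × ℚ)}
    (hP : P.okB = true) (h : P.lpOK S B c lams = true) : P.EFClaim Q dmin dmax f S B := by
  simp only [lpOK, Bool.and_eq_true, decide_eq_true_eq, List.all_eq_true] at h
  obtain ⟨⟨hc, hall⟩, hz⟩ := h
  intro t ht _ _ hS hB
  exfalso
  have heval := P.eval_lpForm B c lams (fun gl hgl => (hall gl hgl).2) (x := flat t)
  rw [QF.eval_of_isZero _ hz] at heval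
  have hsum : 0 ≤ (lams.map fun gl => (gl.2 : ℝ) * seval (flat t) (gl.1.poly P B)).sum := by
    refine List.sum_nonneg ?_
    intro r hr
    obtain ⟨gl, hgl, rfl⟩ := List.mem_map.1 hr
    obtain ⟨⟨hlam, hvalid⟩, -⟩ := hall gl hgl
    exact mul_nonneg (by exact_mod_cast hlam) (Gen.seval_poly_nonneg hP ht hS hB gl.1 hvalid)
  have hc' : (0 : ℝ) < c := by exact_mod_cast hc
  linarith

end Spec

/-! ### Soundness of the checkers -/

/-- **Soundness of the tree checker with LP leaves**: with every claim of the context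
established, an accepted tree establishes the extended claim of its node. [folklore] -/
theorem LTree.check_sound {P : Spec} (Q : P.Patterns) {dmin dmax : ℕ} {f : Option (ℕ × ℕ × ℕ)}
    (hP : P.okB = true) (ctx : Array (List Constraint))
    (hctx : ∀ (j : ℕ) (hj : j < ctx.size), P.EClaim Q dmin dmax f ctx[j]) :
    ∀ (tr : LTree) (S : List Constraint) (ob : Option Box),
      tr.check P dmin dmax f ctx S ob = true → P.ENodeClaim Q dmin dmax f S ob
  | .case k l tb tf, S, ob, h => by
    simp only [LTree.check, Bool.and_eq_true, decide_eq_true_eq, Bool.not_eq_true',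
      beq_eq_false_iff_ne, ne_eq] at h
    obtain ⟨⟨⟨⟨hk, hl⟩, hkl⟩, hb⟩, hf⟩ := h
    exact Spec.enodeClaim_case hk hl hkl (LTree.check_sound Q hP ctx hctx tb _ _ hb)
      (LTree.check_sound Q hP ctx hctx tf _ _ hf)
  | .ref π j, S, ob, h => by
    simp only [LTree.check] at h
    split at h
    · exact absurd h Bool.false_ne_true
    · rename_i S₀ hS₀
      obtain ⟨hj, rfl⟩ := Array.getElem?_eq_some_iff.1 hS₀
      simp only [Bool.and_eq_true, List.all_eq_true, decide_eq_true_eq] at h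
      exact Spec.enodeClaim_of_eclaim (Spec.eclaim_of_relabel h.1.1 h.1.2 h.2 (hctx j hj)) ob
  | .torn k, S, ob, h => by
    simp only [LTree.check] at h
    exact Spec.enodeClaim_of_eclaim (Spec.eclaim_of_torn h) ob
  | .capped k, S, ob, h => by
    simp only [LTree.check] at h
    exact Spec.enodeClaim_of_eclaim (Spec.eclaim_of_capped h) ob
  | .frame sub, S, none, h =>
    Spec.eclaim_of_efclaim_rootBox hP (LTree.check_sound Q hP ctx hctx sub S (some P.rootBox) h)
  | .frame _, _, some _, h => absurd h (by simp [LTree.check])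
  | .split axis cut lo hi, S, some B, h => by
    simp only [LTree.check, Bool.and_eq_true] at h
    exact Spec.efclaim_split axis cut (LTree.check_sound Q hP ctx hctx lo S _ h.1)
      (LTree.check_sound Q hP ctx hctx hi S _ h.2)
  | .split _ _ _ _, _, none, h => absurd h (by simp [LTree.check])
  | .empty w, S, some B, h => Spec.efclaim_of_fclaim (Spec.fclaim_of_witness hP h)
  | .empty _, _, none, h => absurd h (by simp [LTree.check])
  | .aboveFacet l prec, S, some B, h => Spec.efclaim_of_aboveFacet h
  | .aboveFacet _ _, _, none, h => absurd h (by simp [LTree.check])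
  | .accept pat M σ, S, some B, h => Spec.efclaim_of_fclaim (Spec.fclaim_of_accept hP h)
  | .accept _ _ _, _, none, h => absurd h (by simp [LTree.check])
  | .lp c lams, S, some B, h => Spec.efclaim_of_lp hP h
  | .lp _ _, _, none, h => absurd h (by simp [LTree.check])

/-- **Soundness of `LCensus.checkFrom`**: starting from an established context, every entry of
an accepted census is established (also the composition rule across files). [folklore] -/
theorem LCensus.checkFrom_sound {P : Spec} (Q : P.Patterns) {dmin dmax : ℕ}
    {f : Option (ℕ × ℕ × ℕ)} (hP : P.okB = true) :
    ∀ (C : LCensus) (ctx : Array (List Constraint)),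
      (∀ (j : ℕ) (hj : j < ctx.size), P.EClaim Q dmin dmax f ctx[j]) →
      LCensus.checkFrom P dmin dmax f ctx C = true → ∀ e ∈ C, P.EClaim Q dmin dmax f e.1
  | [], _, _, _ => by simp
  | (S, tr) :: rest, ctx, hctx, h => by
    simp only [LCensus.checkFrom, Bool.and_eq_true] at h
    obtain ⟨h1, h2⟩ := h
    have hS : P.EClaim Q dmin dmax f S := LTree.check_sound Q hP ctx hctx tr S none h1
    have hctx' : ∀ (j : ℕ) (hj : j < (ctx.push S).size), P.EClaim Q dmin dmax f (ctx.push S)[j] := by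
      intro j hj
      rw [Array.getElem_push]
      split
      · exact hctx j _
      · exact hS
    intro e he
    rcases List.mem_cons.1 he with rfl | he
    · exact hS
    · exact LCensus.checkFrom_sound Q hP rest (ctx.push S) hctx' h2 e he

/-- **Soundness of the census checker with LP leaves**: an accepted census establishes the
extended claim of the target constraint list. [folklore] -/
theorem LCensus.check_sound {P : Spec} (Q : P.Patterns) {dmin dmax : ℕ} {f : Option (ℕ × ℕ × ℕ)}
    {S : List Constraint} (C : LCensus) (h : LCensus.check P dmin dmax f S C = true) :
    P.EClaim Q dmin dmax f S := by
  simp only [LCensus.check, Bool.and_eq_true, List.any_eq_true, decide_eq_true_eq] at h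
  obtain ⟨⟨hP, hC⟩, e, he, rfl⟩ := h
  exact LCensus.checkFrom_sound Q hP C #[] (fun j hj => absurd hj (by simp)) hC e he

/-- **Infeasibility from an accepted census** (specifications without anchors): no admissible
tuple in the degree window satisfies the facet condition and the target constraints (entry point
of the certificate stubs: `LCensus.infeasible_of_check rfl (LCensus.ofText "…") (by native_decide)`). [folklore] -/
theorem LCensus.infeasible_of_check {P : Spec} (hA : P.anchors = []) {dmin dmax : ℕ}
    {f : Option (ℕ × ℕ × ℕ)} {S : List Constraint} (C : LCensus)
    (h : LCensus.check P dmin dmax f S C = true) :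
    ∀ t : Fin P.n → EuclideanSpace ℝ (Fin 3),
      P.Admissible t → P.DegOK dmin dmax t → P.FacetLE f t → P.Sat S t → False :=
  Spec.EClaim.elim_nil hA (LCensus.check_sound (P.emptyPatterns hA) C h)

end ShellCensus

end Literature.Geometry.DiscreteGeometry
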